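import Literature.NumberTheory.Sieve.MoebiusShiftedPrimesArcsWith
import Literature.NumberTheory.Sieve.MoebiusShiftedPrimesMinorArc
import Literature.NumberTheory.Sieve.MoebiusShiftedPrimesDirichletMeanValue
import HarnessLib

/-!
# Möbius on shifted primes — the minor arcs along the corrected sets `S_c`, and Theorem 1.1 (power range)

Topic `Literature/NumberTheory/Sieve`, part of the decomposition of the named fact
`Literature.NumberTheory.Sieve.lichtman2020_moebius_shifted_primes_avg_power` (J. D. Lichtman,
*Averages of the Möbius function on shifted primes*, Q. J. Math. 73 (2022) 729–757,
arXiv:2009.08969v2 [Lichtman2020], Theorem 1.1, power range) along the CORRECTED typical sets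
`S_c = lichtmanTypicalWith c`, `c ≥ 100` (`MoebiusShiftedPrimesTypical.lean`).  Everything here is
PROVED:

* `Lichtman2020.ramare_error_le'`, `Lichtman2020.minorArc_sum_le'`, `Lichtman2020.minorArc_integral_le'`
  — the minor-arc bound of `MoebiusShiftedPrimesMinorArc.lean` (§3.1 of the paper) with the hypothesis
  `P₁ = W^{33}` of `ramare_error_le` / `minorArc_sum_le` relaxed to `P₁ ≥ W^{33}` (the proofs use only
  `P₁ ≥ 1`, `P₁ ≥ √W` and `W^{33}/2 ≤ 2^j` for the dyadic blocks above `P₁`), hence for `S_c`,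
  `P₁ = (log X)^{cA} = W^c`, every `c ≥ 33`;
* `Lichtman2020_minorArcEstimateWith_holds : Lichtman2020_minorArcEstimateWith` (Proposition 3.1 along
  `S_c`, `c ≥ 100`);
* the assembled power-range theorem
  `lichtman2020_moebius_shifted_primes_avg_power_of_dirichletMeanValueWith
     (h51 : Lichtman2020_dirichletMeanValueWith) (h48 : Lichtman2020_liouvilleCharacterSifted) :
     lichtman2020_moebius_shifted_primes_avg_power`
  (minor arcs here; Prop 3.4_c ⇐ 5.1_c + Lemma 4.8 in `MoebiusShiftedPrimesMeanSquare.lean`;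
  Prop 3.2_c, 2.3_c, Thm 2.2_c in `MoebiusShiftedPrimesArcsWith.lean`; Thm 1.1 ⇐ Thm 2.2_c in
  `MoebiusShiftedPrimesDecompositionWith.lean`).  With Proposition 5.1_c proved from Lemma 4.5
  (`MoebiusShiftedPrimesDirichletMeanValue.lean`,
  `Lichtman2020_dirichletMeanValueWith_of_primeCharacterSum`), the last theorem
  `lichtman2020_moebius_shifted_primes_avg_power_of_primeCharacterSum_of_liouvilleCharacterSifted
     (h45 : Lichtman2020_primeCharacterSum) (h48 : Lichtman2020_liouvilleCharacterSifted)`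
  shows that Theorem 1.1 (power range) rests on exactly the two printed inputs Lemma 4.5 (the
  Vinogradov–Korobov bound for prime character sums) and Lemma 4.8 (fundamental lemma +
  Siegel–Walfisz for `λχ`); every other step of the paper along the corrected sets is proved in the tree.

## Sources

* J. D. Lichtman, arXiv:2009.08969v2, §3.1 (Proposition 3.1, (3.1)–(3.6), pp. 9–10) and the overview of
  the proof of Theorem 1.1 (§§2–5) [Lichtman2020].
-/

open Filter Asymptotics Finset MeasureTheory
open scoped FourierTransform Topology

namespace Literature.NumberTheory.Sieve.Lichtman2020

/-! ### The minor arcs for any `P₁ ≥ W^{33}` -/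

/-- **The error term of the Ramaré step** (p. 9: "We may replace `𝟙_{p ∤ m}` with `1` … at a cost of
`O(HX/dP)`"): `2 ∑_k ∑_{p ∈ Ps} #windowDiv (dp²) H k ≤ 8 HX log H/(d√W)` when the elements of `Ps`
are `≥ P₁ ≥ W³³ ≥ √W` (`∑_{p ≥ P₁} 1/p² ≤ 2/P₁`, `log H ≥ 1`). [cite: Lichtman2020, §3.1, p. 9] -/
theorem ramare_error_le' {X d H : ℕ} {W P₁ : ℝ} (hW : 2 ≤ W) (hd : 1 ≤ d) (hP₁ : W ^ 33 ≤ P₁)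
    (hH : 3 ≤ H) (hHX : H ≤ X) (Ps : Finset ℕ) (hPs : ∀ p ∈ Ps, p.Prime)
    (hPsb : ∀ p ∈ Ps, P₁ ≤ (p : ℝ)) :
    2 * ∑ k ∈ Icc 1 X, ∑ p ∈ Ps, (#(windowDiv (d * p * p) H k) : ℝ) ≤
      8 * ((H : ℝ) * X * Real.log H / (d * Real.sqrt W)) := by
  have hW0 : 0 < W := by linarith
  have hW1 : 1 ≤ W := by linarith
  have hd0 : (0 : ℝ) < d := by exact_mod_cast hd
  have hH3 : (3 : ℝ) ≤ H := by exact_mod_cast hH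
  have hH0 : (0 : ℝ) < H := by linarith
  have hH1 : 1 ≤ H := by omega
  have hHX' : (H : ℝ) ≤ X := by exact_mod_cast hHX
  have hlogH : 1 ≤ Real.log H := by
    rw [Real.le_log_iff_exp_le hH0]
    have := Real.exp_one_lt_d9
    linarith
  have hP₁1 : 1 ≤ P₁ := le_trans (one_le_pow₀ hW1) hP₁
  have hP₁0 : 0 < P₁ := by linarith
  have hsqW : 0 < Real.sqrt W := Real.sqrt_pos.mpr hW0
  rw [Finset.sum_comm]
  have h1 : ∀ p ∈ Ps, ∑ k ∈ Icc 1 X, (#(windowDiv (d * p * p) H k) : ℝ) ≤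
      (H : ℝ) * ((X : ℝ) + H) / d * (1 / (p : ℝ) ^ 2) := by
    intro p hp
    have hp1 := (hPs p hp).one_le
    have h := sum_card_windowDiv_le X H (d * p * p) (Nat.mul_pos (Nat.mul_pos hd hp1) hp1) hH1
    refine h.trans (le_of_eq ?_)
    have hp0 : (0 : ℝ) < p := by exact_mod_cast hp1
    push_cast
    field_simp
  have hA1 : 1 ≤ ⌈P₁⌉₊ := Nat.ceil_pos.mpr hP₁0
  have h2 : ∑ p ∈ Ps, 1 / ((p : ℝ) ^ 2) ≤ 2 / P₁ := by
    have h3 := sum_inv_sq_le_of_le Ps hA1 (fun p hp => Nat.ceil_le.mpr (hPsb p hp))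
    exact h3.trans (div_le_div_of_nonneg_left (by norm_num : (0 : ℝ) ≤ 2) hP₁0 (Nat.le_ceil P₁))
  have hsqrtP₁ : Real.sqrt W ≤ P₁ := by
    calc Real.sqrt W ≤ W := by
          rw [Real.sqrt_le_left (by linarith)]
          nlinarith
      _ ≤ W ^ 33 := le_self_pow₀ hW1 (by norm_num)
      _ ≤ P₁ := hP₁
  calc 2 * ∑ p ∈ Ps, ∑ k ∈ Icc 1 X, (#(windowDiv (d * p * p) H k) : ℝ)
      ≤ 2 * ∑ p ∈ Ps, (H : ℝ) * ((X : ℝ) + H) / d * (1 / (p : ℝ) ^ 2) :=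
        mul_le_mul_of_nonneg_left (Finset.sum_le_sum h1) (by norm_num)
    _ = 2 * ((H : ℝ) * ((X : ℝ) + H) / d) * ∑ p ∈ Ps, 1 / (p : ℝ) ^ 2 := by
        rw [← Finset.mul_sum]; ring
    _ ≤ 2 * ((H : ℝ) * ((X : ℝ) + H) / d) * (2 / P₁) :=
        mul_le_mul_of_nonneg_left h2 (by positivity)
    _ ≤ 2 * ((H : ℝ) * (2 * X) / d) * (2 * (Real.log H / Real.sqrt W)) := by
        apply mul_le_mul _ _ (by positivity) (by positivity)
        · apply mul_le_mul_of_nonneg_left _ (by norm_num)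
          apply div_le_div_of_nonneg_right _ hd0.le
          nlinarith
        · rw [div_eq_mul_one_div]
          apply mul_le_mul_of_nonneg_left _ (by norm_num)
          rw [div_le_div_iff₀ hP₁0 hsqW]
          nlinarith
    _ = 8 * ((H : ℝ) * X * Real.log H / (d * Real.sqrt W)) := by
        field_simp
        ring

/-- (Along any `P₁ ≥ W^{33}`; as `minorArc_sum_le` with the hypothesis `P₁ = W^{33}` relaxed.) **The minor arc bound of Lichtman 2020, §3.1, at a fixed `X` (discrete form).**  Let `2 ≤ W`,
`1 ≤ d ≤ W`, `P₁ = W³³`, `Q₁ = H/W⁴ < P₂`, `3 ≤ H ≤ X`, `S(n) ⟺` (`n` has a prime factor in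
`[P₁, Q₁]` and one in `[P₂, Q₂]`), `g` completely multiplicative with `|g| ≤ 1`, `α ∈ 𝔪(W, Q₁)`.
Then `∑_{k ≤ X} |∑_{n ∈ windowDiv d H k ∩ S} g(n) e(nα)| ≤ 600 · HX log H/(d √W)`.
(The paper's (3.1) is `≪ HX (log log X/(dW))^{1/2} ψ(X)`; the present form, with `1/d` for
`1/√d` and `log H` for `√(log log X) ψ(X)`, comes from the explicit Vinogradov lemma with its
logarithm and the trivial count of prime pairs, and suffices for Theorem 2.2.)
[cite: Lichtman2020, §3.1, (3.1)–(3.6)] -/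
theorem minorArc_sum_le' {X d H : ℕ} {W P₁ Q₁ P₂ Q₂ : ℝ} (hW : 2 ≤ W) (hd : 1 ≤ d)
    (hdW : (d : ℝ) ≤ W) (hP₁ : W ^ 33 ≤ P₁) (hQ₁ : Q₁ = H / W ^ 4) (hQP : Q₁ < P₂)
    (hH : 3 ≤ H) (hHX : H ≤ X) (S : ℕ → Prop) [DecidablePred S]
    (hSiff : ∀ n, S n ↔ HasPrimeFactorIn P₁ Q₁ n ∧ HasPrimeFactorIn P₂ Q₂ n)
    (g : ℕ → ℂ) (hgmul : ∀ m n, g (m * n) = g m * g n) (hg : ∀ n, ‖g n‖ ≤ 1)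
    {α : ℝ} (hα : α ∈ lichtmanMinorArcs W Q₁) :
    ∑ k ∈ Icc 1 X, ‖twistedSum g ((windowDiv d H k).filter S) α‖ ≤
      600 * ((H : ℝ) * X * Real.log H / (d * Real.sqrt W)) := by
  classical
  -- basic real facts
  have hW0 : 0 < W := by linarith
  have hW1 : 1 ≤ W := by linarith
  have hH3 : (3 : ℝ) ≤ H := by exact_mod_cast hH
  have hH0 : (0 : ℝ) < H := by linarith
  have hlogH : 1 ≤ Real.log H := by
    rw [Real.le_log_iff_exp_le hH0]
    have := Real.exp_one_lt_d9
    linarith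
  have hP₁1 : 1 ≤ P₁ := le_trans (one_le_pow₀ hW1) hP₁
  have hQ₁H : Q₁ ≤ H := by
    rw [hQ₁]
    exact div_le_self hH0.le (one_le_pow₀ hW1)
  have hΛ3 : 1 + 2 * Real.log H ≤ 3 * Real.log H := by linarith
  -- the primes of `[P₁, Q₁]`
  set Ps : Finset ℕ := (Finset.range (⌊Q₁⌋₊ + 1)).filter
    (fun p => p.Prime ∧ P₁ ≤ (p : ℝ) ∧ (p : ℝ) ≤ Q₁) with hPs_def
  have hPs : ∀ p ∈ Ps, p.Prime := fun p hp => (Finset.mem_filter.mp hp).2.1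
  have hPsb : ∀ p ∈ Ps, P₁ ≤ (p : ℝ) ∧ (p : ℝ) ≤ Q₁ := fun p hp => (Finset.mem_filter.mp hp).2.2
  have hPsQ : ∀ p ∈ Ps, p ≤ ⌊Q₁⌋₊ := fun p hp => by
    have := Finset.mem_range.mp (Finset.mem_filter.mp hp).1; omega
  have hS : ∀ n, S n → n ≠ 0 ∧ ∃ p ∈ Ps, p ∣ n := by
    intro n hn
    obtain ⟨⟨p, hp, hP, hQ⟩, -⟩ := (hSiff n).mp hn
    obtain ⟨hpr, hpn, hn0⟩ := Nat.mem_primeFactors.mp hp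
    refine ⟨hn0, p, ?_, hpn⟩
    rw [hPs_def, Finset.mem_filter, Finset.mem_range]
    refine ⟨?_, hpr, hP, hQ⟩
    have : p ≤ ⌊Q₁⌋₊ := Nat.le_floor hQ
    omega
  have hS₂ : ∀ p ∈ Ps, ∀ m, m ≠ 0 → (S (m * p) ↔ HasPrimeFactorIn P₂ Q₂ m) := by
    intro p hp m hm
    have hpr := hPs p hp
    obtain ⟨hP, hQ⟩ := hPsb p hp
    rw [hSiff]
    have h1 : HasPrimeFactorIn P₁ Q₁ (m * p) :=
      ⟨p, Nat.mem_primeFactors.mpr ⟨hpr, dvd_mul_left p m, Nat.mul_ne_zero hm hpr.ne_zero⟩, hP, hQ⟩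
    have h2 : HasPrimeFactorIn P₂ Q₂ (m * p) ↔ HasPrimeFactorIn P₂ Q₂ m := by
      rw [mul_comm]
      apply hasPrimeFactorIn_mul_iff hpr.ne_zero
      intro q hq
      rw [Nat.Prime.primeFactors hpr, Finset.mem_singleton] at hq
      rw [hq]; exact lt_of_le_of_lt hQ hQP
    rw [h2]
    exact ⟨fun h => h.2, fun h => ⟨h1, h⟩⟩
  -- the Ramaré coefficients and the dyadic blocks
  set c : ℕ → ℂ := fun m => if HasPrimeFactorIn P₂ Q₂ m then
    g m / ((#(Ps.filter (· ∣ m)) : ℂ) + 1) else 0 with hc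
  have hcle : ∀ m, ‖c m‖ ≤ 1 := fun m => norm_ramareCoeff_le Ps (HasPrimeFactorIn P₂ Q₂) g hg m
  set J : ℕ := Nat.log 2 ⌊Q₁⌋₊ with hJ
  have hJ3 : (((J + 1 : ℕ)) : ℝ) ≤ 3 * Real.log H := log_two_floor_add_one_le hH hQ₁H
  set Qj : ℕ → Finset ℕ := fun j => Ps.filter (fun p => Nat.log 2 p = j) with hQj_def
  have hQjP : ∀ j, ∀ p ∈ Qj j, p ∈ Ps := fun j p hp => (Finset.mem_filter.mp hp).1
  have hQj : ∀ j, ∀ p ∈ Qj j, 2 ^ j ≤ p ∧ p < 2 * 2 ^ j := by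
    intro j p hp
    obtain ⟨hpP, hj⟩ := Finset.mem_filter.mp hp
    subst hj
    have hp0 : p ≠ 0 := (hPs p hpP).ne_zero
    refine ⟨Nat.pow_log_le_self 2 hp0, ?_⟩
    rw [← pow_succ']
    exact Nat.lt_pow_succ_log_self one_lt_two p
  have hmaps : ∀ p ∈ Ps, Nat.log 2 p ∈ Finset.range (J + 1) := by
    intro p hp
    rw [Finset.mem_range, Nat.lt_succ_iff, hJ]
    exact Nat.log_mono_right (hPsQ p hp)
  set G : ℕ → ℕ → ℂ := fun j k => ∑ p ∈ Qj j, ∑ m ∈ windowDiv (d * p) H k,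
      c m * g p * (𝐞 (((m * p : ℕ) : ℝ) * α) : ℂ) with hG
  -- Step 1: per-window decomposition
  have hdecomp : ∀ k ∈ Icc 1 X, ‖twistedSum g ((windowDiv d H k).filter S) α‖ ≤
      ∑ j ∈ Finset.range (J + 1), ‖G j k‖ +
        2 * ∑ p ∈ Ps, (#(windowDiv (d * p * p) H k) : ℝ) := by
    intro k hk
    have hk1 : 1 ≤ k := (Finset.mem_Icc.mp hk).1
    have hR := norm_twistedSum_sub_ramare_le (d := d) (H := H) hk1 Ps hPs S
      (HasPrimeFactorIn P₂ Q₂) hS hS₂ g hgmul hg α c (fun m => rfl)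
    have hmain : ∑ p ∈ Ps, ∑ m ∈ windowDiv (d * p) H k,
        c m * g p * (𝐞 (((m * p : ℕ) : ℝ) * α) : ℂ) = ∑ j ∈ Finset.range (J + 1), G j k := by
      simp only [hG, hQj_def]
      exact (Finset.sum_fiberwise_of_maps_to hmaps _).symm
    calc ‖twistedSum g ((windowDiv d H k).filter S) α‖
        = ‖(twistedSum g ((windowDiv d H k).filter S) α -
            ∑ p ∈ Ps, ∑ m ∈ windowDiv (d * p) H k,
              c m * g p * (𝐞 (((m * p : ℕ) : ℝ) * α) : ℂ)) +
            ∑ j ∈ Finset.range (J + 1), G j k‖ := by rw [← hmain, sub_add_cancel]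
      _ ≤ 2 * ∑ p ∈ Ps, (#(windowDiv (d * p * p) H k) : ℝ) +
            ∑ j ∈ Finset.range (J + 1), ‖G j k‖ :=
          (norm_add_le _ _).trans (add_le_add hR (norm_sum_le _ _))
      _ = _ := by ring
  -- Step 2: the error term
  have herr := ramare_error_le' (X := X) hW hd hP₁ hH hHX Ps hPs (fun p hp => (hPsb p hp).1)
  -- Step 3: the blocks
  have hY0 : 0 ≤ (H : ℝ) * X * Real.sqrt (1 + 2 * Real.log H) / (d * Real.sqrt W) := by positivity
  have hblock : ∀ j ∈ Finset.range (J + 1), ∑ k ∈ Icc 1 X, ‖G j k‖ ≤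
      86 * ((H : ℝ) * X * Real.sqrt (1 + 2 * Real.log H) / (d * Real.sqrt W)) *
        (1 / Real.sqrt ((j : ℝ) + 1)) := by
    intro j _
    rcases (Qj j).eq_empty_or_nonempty with hempty | ⟨p₀, hp₀⟩
    · -- empty block
      have h0 : ∀ k, G j k = 0 := fun k =>
        Finset.sum_eq_zero fun p hp => absurd hp (by rw [hempty]; exact Finset.notMem_empty p)
      rw [Finset.sum_eq_zero (fun k _ => by rw [h0 k, norm_zero])]
      positivity
    · -- a nonempty block: `2^j ≥ P₁/2`, `2^j ≤ Q₁`
      obtain ⟨hp₀P, -⟩ := hQj j p₀ hp₀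
      obtain ⟨hp₀P₁, hp₀Q₁⟩ := hPsb p₀ (hQjP j p₀ hp₀)
      have hPp₀ : (2 : ℝ) ^ j ≤ p₀ := by exact_mod_cast hp₀P
      have hPQ : (2 : ℝ) ^ j ≤ Q₁ := hPp₀.trans hp₀Q₁
      have hPW : W ^ 33 / 2 ≤ (2 : ℝ) ^ j := by
        have h2 : (p₀ : ℝ) < 2 * (2 : ℝ) ^ j := by exact_mod_cast (hQj j p₀ hp₀).2
        linarith
      have hQ₁1 : 1 ≤ Q₁ := hP₁1.trans (hp₀P₁.trans hp₀Q₁)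
      exact block_bound hW hd hdW hQ₁ hH hHX (Qj j) (fun p hp => hPs p (hQjP j p hp)) (hQj j)
        hPW hPQ hQ₁1 c g hcle hg hα
  have hblocks : ∑ j ∈ Finset.range (J + 1), ∑ k ∈ Icc 1 X, ‖G j k‖ ≤
      516 * ((H : ℝ) * X * Real.log H / (d * Real.sqrt W)) := by
    calc ∑ j ∈ Finset.range (J + 1), ∑ k ∈ Icc 1 X, ‖G j k‖
        ≤ ∑ j ∈ Finset.range (J + 1), 86 * ((H : ℝ) * X * Real.sqrt (1 + 2 * Real.log H) /
            (d * Real.sqrt W)) * (1 / Real.sqrt ((j : ℝ) + 1)) := Finset.sum_le_sum hblock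
      _ = 86 * ((H : ℝ) * X * Real.sqrt (1 + 2 * Real.log H) / (d * Real.sqrt W)) *
            ∑ j ∈ Finset.range (J + 1), 1 / Real.sqrt ((j : ℝ) + 1) := by rw [Finset.mul_sum]
      _ ≤ 86 * ((H : ℝ) * X * Real.sqrt (1 + 2 * Real.log H) / (d * Real.sqrt W)) *
            (2 * Real.sqrt ((J + 1 : ℕ) : ℝ)) :=
          mul_le_mul_of_nonneg_left (sum_inv_sqrt_le (J + 1)) (by positivity)
      _ = 172 * ((H : ℝ) * X / (d * Real.sqrt W)) *
            (Real.sqrt (1 + 2 * Real.log H) * Real.sqrt ((J + 1 : ℕ) : ℝ)) := by ring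
      _ ≤ 172 * ((H : ℝ) * X / (d * Real.sqrt W)) * (3 * Real.log H) := by
          apply mul_le_mul_of_nonneg_left _ (by positivity)
          calc Real.sqrt (1 + 2 * Real.log H) * Real.sqrt ((J + 1 : ℕ) : ℝ)
              ≤ Real.sqrt (3 * Real.log H) * Real.sqrt (3 * Real.log H) :=
                mul_le_mul (Real.sqrt_le_sqrt hΛ3) (Real.sqrt_le_sqrt hJ3) (Real.sqrt_nonneg _)
                  (Real.sqrt_nonneg _)
            _ = 3 * Real.log H := Real.mul_self_sqrt (by linarith)
      _ = 516 * ((H : ℝ) * X * Real.log H / (d * Real.sqrt W)) := by ring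
  -- assembly
  calc ∑ k ∈ Icc 1 X, ‖twistedSum g ((windowDiv d H k).filter S) α‖
      ≤ ∑ k ∈ Icc 1 X, (∑ j ∈ Finset.range (J + 1), ‖G j k‖ +
          2 * ∑ p ∈ Ps, (#(windowDiv (d * p * p) H k) : ℝ)) := Finset.sum_le_sum hdecomp
    _ = ∑ j ∈ Finset.range (J + 1), ∑ k ∈ Icc 1 X, ‖G j k‖ +
          2 * ∑ k ∈ Icc 1 X, ∑ p ∈ Ps, (#(windowDiv (d * p * p) H k) : ℝ) := by
        rw [Finset.sum_add_distrib, Finset.sum_comm, Finset.mul_sum]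
    _ ≤ 516 * ((H : ℝ) * X * Real.log H / (d * Real.sqrt W)) +
          8 * ((H : ℝ) * X * Real.log H / (d * Real.sqrt W)) := add_le_add hblocks herr
    _ ≤ 600 * ((H : ℝ) * X * Real.log H / (d * Real.sqrt W)) := by
        have : 0 ≤ (H : ℝ) * X * Real.log H / (d * Real.sqrt W) := by positivity
        linarith

/-! ### The minor arc bound, eventually in `X` -/

open Filter Asymptotics MeasureTheory
open scoped Topology

/-- **The minor arc bound along `S_c` (`c ≥ 33`), eventually** (the regime of Proposition 3.1 / (3.1): `A > 0`, `δ ≥ 0`,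
`ψ(X) = log H/log log X → ∞`, `H ≤ exp((log X)^{2/3})`): for `X` large, all `1 ≤ d ≤ W = (log X)^A`,
all completely multiplicative `|g| ≤ 1` and all `α ∈ 𝔪(W, H/W⁴)`,
`∫₀^X |∑_{x ≤ nd ≤ x+H, n ∈ S_d} g(n) e(nα)| dx ≤ 600 HX log H/(d√W)` (discretised by
`integral_window_div_eq_sum`, then `minorArc_sum_le`; `Q₁ = H/W⁴ < H ≤ P₂` in the regime).
[cite: Lichtman2020, Proposition 3.1 and (3.1)] -/
theorem minorArc_integral_le' (c : ℝ) (hc : 33 ≤ c) (A : ℝ) (hA : 0 < A) (δ : ℝ) (hδ : 0 ≤ δ) (H : ℕ → ℕ)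
    (hH : Tendsto (fun X : ℕ => Real.log (H X) / Real.log (Real.log X)) atTop atTop)
    (hHexp : ∀ᶠ X : ℕ in atTop, (H X : ℝ) ≤ Real.exp (Real.log X ^ (2 / 3 : ℝ))) :
    ∀ᶠ X : ℕ in atTop, ∀ d : ℕ, 1 ≤ d → (d : ℝ) ≤ Real.log X ^ A →
      ∀ g : ℕ → ℂ, (∀ m n : ℕ, g (m * n) = g m * g n) → (∀ n : ℕ, ‖g n‖ ≤ 1) →
      ∀ α ∈ lichtmanMinorArcs (Real.log X ^ A) ((H X : ℝ) / Real.log X ^ (4 * A)),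
        ∫ x in (0 : ℝ)..X,
            ‖twistedSum g ((Icc ⌈x / d⌉₊ ⌊(x + H X) / d⌋₊).filter (lichtmanTypicalWith c X A δ (H X))) α‖
          ≤ 600 * ((H X : ℝ) * X * Real.log (H X) / (d * Real.sqrt (Real.log X ^ A))) := by
  have hW2 : ∀ᶠ X : ℕ in atTop, 2 ≤ Real.log X ^ A :=
    ((tendsto_rpow_atTop hA).comp tendsto_log_natCast).eventually_ge_atTop 2
  filter_upwards [hHexp, hW2, eventually_three_le_H hH, tendsto_log_natCast.eventually_ge_atTop 1,
    eventually_gt_atTop 0] with X hHX hW2X h3 hL1 hX0 d hd hdW g hgmul hg α hα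
  have hX0' : (0 : ℝ) < X := by exact_mod_cast hX0
  have hL0 : 0 < Real.log X := by linarith
  set L : ℝ := Real.log X with hL
  set W : ℝ := L ^ A with hW
  have hW0 : 0 < W := by rw [hW]; exact Real.rpow_pos_of_pos hL0 _
  have hH0 : (0 : ℝ) < H X := by
    have : (3 : ℝ) ≤ H X := by exact_mod_cast h3
    linarith
  -- the parameters of `minorArc_sum_le`
  have hP₁ : W ^ 33 ≤ L ^ (c * A) := by
    have e : W ^ 33 = L ^ (33 * A) := by
      rw [hW, ← Real.rpow_natCast, ← Real.rpow_mul hL0.le]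
      norm_num
      ring_nf
    rw [e]
    exact Real.rpow_le_rpow_of_exponent_le hL1 (by nlinarith)
  have hW4 : L ^ (4 * A) = W ^ 4 := by
    rw [hW, ← Real.rpow_natCast, ← Real.rpow_mul hL0.le]
    norm_num
    ring_nf
  have hQ₁ : (H X : ℝ) / L ^ (4 * A) = (H X : ℝ) / W ^ 4 := by rw [hW4]
  have hHleX : H X ≤ X := by
    have h2 : L ^ (2 / 3 : ℝ) ≤ L := by
      calc L ^ (2 / 3 : ℝ) ≤ L ^ (1 : ℝ) := Real.rpow_le_rpow_of_exponent_le hL1 (by norm_num)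
        _ = L := Real.rpow_one _
    have h3 : (H X : ℝ) ≤ X := by
      calc (H X : ℝ) ≤ Real.exp (L ^ (2 / 3 : ℝ)) := hHX
        _ ≤ Real.exp L := Real.exp_le_exp.mpr h2
        _ = X := by rw [hL]; exact Real.exp_log hX0'
    exact_mod_cast h3
  have hQP : (H X : ℝ) / L ^ (4 * A) < Real.exp (L ^ (2 / 3 + δ / 2)) := by
    have h1 : (H X : ℝ) / L ^ (4 * A) < H X := by
      rw [hW4, div_lt_iff₀ (by positivity)]
      have hW41 : 1 < W ^ 4 := by
        have : (2 : ℝ) ^ 4 ≤ W ^ 4 := pow_le_pow_left₀ (by norm_num) hW2X 4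
        linarith [show (16 : ℝ) = 2 ^ 4 by norm_num]
      nlinarith
    have h2 : (H X : ℝ) ≤ Real.exp (L ^ (2 / 3 + δ / 2)) :=
      hHX.trans (Real.exp_le_exp.mpr (Real.rpow_le_rpow_of_exponent_le hL1 (by linarith)))
    linarith
  rw [integral_window_div_eq_sum (fun s => ‖twistedSum g (s.filter
    (lichtmanTypicalWith c X A δ (H X))) α‖) X (H X) d hd]
  exact minorArc_sum_le' (P₁ := L ^ (c * A)) (Q₂ := Real.exp (L ^ (1 - δ / 2))) hW2X hd hdW hP₁
    hQ₁ hQP h3 hHleX (lichtmanTypicalWith c X A δ (H X)) (fun n => Iff.rfl) g hgmul hg hα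

end Literature.NumberTheory.Sieve.Lichtman2020

namespace Literature.NumberTheory.Sieve

open Filter Finset MeasureTheory Lichtman2020
open scoped Topology

/-- **Proposition 3.1 of Lichtman 2020 (key minor arc estimate) along `S_c`, `c ≥ 100`, PROVED** in
the vendored form `Lichtman2020_minorArcEstimateWith` (`MoebiusShiftedPrimesArcsWith.lean`; as
`Lichtman2020_minorArcEstimate_holds` for all `δ ≥ 0`, regime
`H ≤ exp((log X)^{2/3})`, bound `C · HX/(d^{3/4} W^{1/5})` with `W = (log X)^A`): by
`minorArc_integral_le` the integral is at most `600 HX log H/(d√W)`, and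
`log H ≤ (log X)^{2/3}`, `(log X)^{2/3 + A/5} ≤ (log X)^{A/2}` (`A > 5`, `log X ≥ 1`) and
`d^{3/4} ≤ d` give `600 HX log H/(d√W) ≤ 600 HX/(d^{3/4} W^{1/5})`.  (The printed passage from (3.1)
to Proposition 3.1 loses for large `ψ`, see `Lichtman2020_minorArcBound31`; the proved bound, with
`1/d` in place of `1/√d`, does not.) [cite: Lichtman2020, Proposition 3.1] -/
theorem Lichtman2020_minorArcEstimateWith_holds : Lichtman2020_minorArcEstimateWith := by
  intro c hc A hA δ hδ H hH hHexp
  have hA0 : 0 < A := by linarith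
  refine ⟨600, ?_⟩
  filter_upwards [minorArc_integral_le' c (by linarith) A hA0 δ hδ H hH hHexp, hHexp, eventually_three_le_H hH,
    tendsto_log_natCast.eventually_ge_atTop 1] with X hX hHX h3 hL1 d hd hdW g _hg1 hgmul hg α hα
  refine (hX d hd hdW g hgmul hg α hα).trans ?_
  set L : ℝ := Real.log X with hL
  have hL0 : 0 < L := by linarith
  have hH3 : (3 : ℝ) ≤ H X := by exact_mod_cast h3
  have hH0 : (0 : ℝ) < H X := by linarith
  have hd1 : (1 : ℝ) ≤ d := by exact_mod_cast hd
  have hd0 : (0 : ℝ) < d := by linarith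
  have hlogH : Real.log (H X) ≤ L ^ (2 / 3 : ℝ) := by
    have := Real.log_le_log hH0 hHX
    rwa [Real.log_exp] at this
  have hlogH0 : 0 ≤ Real.log (H X) := Real.log_nonneg (by linarith)
  have hsqrt : Real.sqrt (L ^ A) = L ^ (A / 2) := by
    rw [Real.sqrt_eq_rpow, ← Real.rpow_mul hL0.le]
    ring_nf
  have hd34 : (d : ℝ) ^ (3 / 4 : ℝ) ≤ d := by
    calc (d : ℝ) ^ (3 / 4 : ℝ) ≤ (d : ℝ) ^ (1 : ℝ) :=
          Real.rpow_le_rpow_of_exponent_le hd1 (by norm_num)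
      _ = d := Real.rpow_one _
  have hkey : Real.log (H X) * L ^ (A / 5) ≤ L ^ (A / 2) := by
    calc Real.log (H X) * L ^ (A / 5) ≤ L ^ (2 / 3 : ℝ) * L ^ (A / 5) :=
          mul_le_mul_of_nonneg_right hlogH (by positivity)
      _ = L ^ (2 / 3 + A / 5) := by rw [← Real.rpow_add hL0]
      _ ≤ L ^ (A / 2) := Real.rpow_le_rpow_of_exponent_le hL1 (by linarith)
  have hHX0 : 0 ≤ (H X : ℝ) * X := by positivity
  apply mul_le_mul_of_nonneg_left _ (by norm_num)
  rw [hsqrt, div_le_div_iff₀ (by positivity) (by positivity)]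
  calc (H X : ℝ) * X * Real.log (H X) * ((d : ℝ) ^ (3 / 4 : ℝ) * L ^ (A / 5))
      = (H X : ℝ) * X * ((d : ℝ) ^ (3 / 4 : ℝ) * (Real.log (H X) * L ^ (A / 5))) := by ring
    _ ≤ (H X : ℝ) * X * (d * L ^ (A / 2)) := by
        apply mul_le_mul_of_nonneg_left _ hHX0
        exact mul_le_mul hd34 hkey (by positivity) (by positivity)

/-- **Lichtman 2020, Theorem 1.1 (power range) from Proposition 5.1_c and Lemma 4.8**: for
`H = X^θ`, `θ ∈ (0,1)`, `δ > 0`, `∑_{h ≤ H} |∑_{p ≤ X} μ(p+h)| ≪_{θ,δ} H π(X)/(log X)^{1/3-δ}`, assembled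
from the minor arcs along `S_c` (this file), Proposition 3.4_c ⇐ 5.1_c + Lemma 4.8, the major arcs,
Proposition 2.3_c, Theorem 2.2_c and the power-range deduction (module docstring).
[cite: Lichtman2020, Theorem 1.1] -/
theorem lichtman2020_moebius_shifted_primes_avg_power_of_dirichletMeanValueWith
    (h51 : Lichtman2020_dirichletMeanValueWith) (h48 : Lichtman2020_liouvilleCharacterSifted) :
    lichtman2020_moebius_shifted_primes_avg_power :=
  lichtman2020_moebius_shifted_primes_avg_power_of_minorArcWith
    Lichtman2020_minorArcEstimateWith_holds h51 h48

/-- **Lichtman 2020, Theorem 1.1 (power range), conditional on exactly Lemma 4.5 and Lemma 4.8 of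
the paper** (`Lichtman2020_primeCharacterSum`, `Lichtman2020_liouvilleCharacterSifted`): all other
steps (Thm 1.1 ⇐ Thm 2.2 ⇐ Prop 2.3 ⇐ Props 3.1 + 3.2 ⇐ Prop 3.4 ⇐ Prop 5.1 + Lemma 4.8;
Prop 5.1 ⇐ Lemmas 4.1, 4.3, 4.4, 4.5, 4.7) are proved in the tree along the corrected typical sets
`S_c`, `c = 100`. [cite: Lichtman2020, Theorem 1.1] -/
theorem lichtman2020_moebius_shifted_primes_avg_power_of_primeCharacterSum_of_liouvilleCharacterSifted
    (h45 : Lichtman2020_primeCharacterSum) (h48 : Lichtman2020_liouvilleCharacterSifted) :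
    lichtman2020_moebius_shifted_primes_avg_power :=
  lichtman2020_moebius_shifted_primes_avg_power_of_dirichletMeanValueWith
    (Lichtman2020_dirichletMeanValueWith_of_primeCharacterSum h45) h48

end Literature.NumberTheory.Sieve
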